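import Summits.QuantumFields.BalabanUV.Beta.SymmetrisedDressingReflection
import Summits.QuantumFields.BalabanUV.Beta.KernelOrthoProjector

/-!
# `BalabanUV.Beta.SymSliceBlockMatrix` — binder row D1, JSB12SYM-SPINE v1.1 (Σ3) step K1-b part 1: THE BLOCK MATRIX `Gmat N` OF THE SYMMETRISED GAUGE
# FUNCTIONAL (rows: non-root block sites, columns: interior block bonds), its RIGHT INVERSE `Dmat N` (`Gmat * Dmat = 1` ⇒ full row rank ⇒ the kernel
# projector `kerProj (Gmat N)` of `KernelOrthoProjector` is available), the FINITE EXPANSION of `symTreeGaugeAt` over interior bonds, and the two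
# RANGE FACTS at block level: columns of `Π^{sym}_bm` lie in `ker Gmat` (so `kerProj` fixes them) and kernel vectors of `Gmat` define gauge-fixed forms
# (so `Π^{sym}_bm` fixes them) — the inputs of the `MKer` packing `symE` (part 2) and of the four `RelInv` rules (K2)

CHART (RULING R-D1-g25-4): chart (II) — the FIXED κ = 0 slice `ker G_sym`; the slice-exchange row hSX is a separate binder, not in this file.
HONEST FRAMING (cell contract, verbatim): «discharging `BetaPertH` makes Bałaban's UV stability UNCONDITIONAL — a real constructive-QFT
result; it is NOT the continuum limit and NOT the Clay problem.»  THIS MODULE DISCHARGES NOTHING of `BetaPertH` ∕ row D1: [folklore] finite linear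
algebra + support bookkeeping of OUR objects.  0 sorry, 0 `def … : Prop` carrying a citation, nothing cited.  NOT D1, NOT BetaPertH, NOT continuum, NOT Clay.
HONEST DEPENDENCY (verbatim): «continuum YM on T⁴ ⇐ BetaPertH ∧ nine spine estimates (0/9 proved); BetaPertH ⇐ (D1) ∧ (D4) ∧ CAP+tail;
G-an2-4 gates asym, D1 and NE2/3/4.»  ABSOLUTE RULE (cell, verbatim): «No internally-minted statement may enter as a cited fact. Every
hypothesis is either kernel-proved in this package or a verbatim quotation of a PUBLISHED theorem with page reference.»
Unit `b2b-balaban-beta-an2` gen 25 (row-D1 owner), 2026-08-21.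
-/

namespace Summit.QuantumFields.BalabanUV.Beta.SymSliceBlockMatrix

noncomputable section

open Finset Matrix
open scoped BigOperators Nat
open Literature.MathematicalPhysics.QuantumFieldTheory
open Literature.MathematicalPhysics.QuantumFieldTheory.Balaban1983to89
open Literature.MathematicalPhysics.QuantumFieldTheory.Balaban1983to89.Beta
open AffineAveraging (Form0 Form1 Site unitVec unitVec_apply box toSite blockSum)
open AveragingContours (blk grad shift blk_block axial axial_sum_sub)
open AveragingContoursRooted (ctr ctrOff ctrOff_mem_box)
open AxialProjector (zsmul_blk_le lt_zsmul_blk_add)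
open Summit.QuantumFields.BalabanUV.Beta.KernelPermutation (psite psite_apply psite_symm_apply)
open Summit.QuantumFields.BalabanUV.Beta.ResolventPermutation (P1 P1_apply)
open Summit.QuantumFields.BalabanUV.Beta.AxialDressingRooted (bondInd bondInd_apply InHull mem_axial_hull)
open Summit.QuantumFields.BalabanUV.Beta.SymmetrisedAxialPotential
open Summit.QuantumFields.BalabanUV.Beta.SymmetrisedAxialGauge
open Summit.QuantumFields.BalabanUV.Beta.SymmetrisedAxialGaugeBlockMean
open Summit.QuantumFields.BalabanUV.Beta.SymmetrisedDressingMatrix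
open Summit.QuantumFields.BalabanUV.Beta.KernelOrthoProjector

variable {n : ℕ}

/-! ## §1 The symmetrised tree gauge reads only the bonds of the block (support ⇒ congruence) -/

/-- [folklore] Two forms agreeing on the bonds of the hull of `y, x` have the same comb integral. -/
theorem axial_sum_congr_of_hull {A A' : Form1 n ℝ} {y x : Site n}
    (h : ∀ κ z, InHull y x z → InHull y x (z + unitVec κ) → A κ z = A' κ z) : (axial A y x).sum = (axial A' y x).sum := by
  rw [← sub_eq_zero, ← axial_sum_sub]
  apply List.sum_eq_zero
  intro a ha
  obtain ⟨κ, z', e, hz, hz'⟩ := mem_axial_hull ha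
  have h0 : (A - A') κ z' = 0 := by rw [Pi.sub_apply, Pi.sub_apply, h κ z' hz hz', sub_self]
  rcases e with e | e
  · rw [e, h0]
  · rw [e, h0, neg_zero]

/-- [folklore] Hulls transport under the axis permutation. -/
theorem inHull_psite_symm {σ : Equiv.Perm (Fin n)} {y x z : Site n} : InHull ((psite σ).symm y) ((psite σ).symm x) z ↔ InHull y x (psite σ z) := by
  constructor
  · intro h j
    have := h (σ.symm j)
    simpa [psite_symm_apply, psite_apply] using this
  · intro h j
    have := h (σ j)
    simpa [psite_symm_apply, psite_apply] using this

/-- [folklore] Two forms agreeing on the bonds of the hull of `y, x` have the same σ-comb integral, every order. -/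
theorem axialPerm_congr_of_hull (σ : Equiv.Perm (Fin n)) {A A' : Form1 n ℝ} {y x : Site n}
    (h : ∀ κ z, InHull y x z → InHull y x (z + unitVec κ) → A κ z = A' κ z) : axialPerm σ A y x = axialPerm σ A' y x := by
  unfold axialPerm
  apply axial_sum_congr_of_hull
  intro κ z hz hz'
  simp only [P1_apply]
  apply h
  · exact inHull_psite_symm.1 hz
  · have e : psite σ (z + unitVec κ) = psite σ z + unitVec (σ κ) := by
      rw [KernelPermutation.psite_add, ResolventPermutation.psite_unitVec]
    rw [← e]; exact inHull_psite_symm.1 hz'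

/-- [folklore] … hence the same symmetrised potential. -/
theorem symAxial_congr_of_hull {A A' : Form1 n ℝ} {y x : Site n}
    (h : ∀ κ z, InHull y x z → InHull y x (z + unitVec κ) → A κ z = A' κ z) : symAxial A y x = symAxial A' y x := by
  unfold symAxial
  exact Finset.sum_congr rfl fun σ _ => axialPerm_congr_of_hull σ h

/-- [folklore] A hull point of two points of one block lies in that block (in-block root). -/
theorem blk_eq_of_inHull {N : ℕ} (hN : 1 ≤ N) {r : Fin n → ℕ} (hr : r ∈ box n N) {Y : Site n} {b : Fin n → ℕ} (hb : b ∈ box n N) {z : Site n}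
    (hz : InHull ((N : ℤ) • Y + toSite r) ((N : ℤ) • Y + toSite b) z) : blk N z = Y := by
  apply blk_eq_of_bounds hN
  intro j
  have hrj : ((r j : ℕ) : ℤ) < N := by exact_mod_cast Finset.mem_range.1 (Fintype.mem_piFinset.1 hr j)
  have hbj : ((b j : ℕ) : ℤ) < N := by exact_mod_cast Finset.mem_range.1 (Fintype.mem_piFinset.1 hb j)
  have k := hz.bounds (j := j) (L := ((N : ℤ) • Y) j) (U := ((N : ℤ) • Y) j + N - 1)
    (by simp [toSite]) (by simp [toSite]; omega) (by simp [toSite]) (by simp [toSite]; omega)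
  exact k

/-- [folklore] **THE SYMMETRISED TREE GAUGE READS ONLY THE BONDS OF THE BLOCK**: two forms agreeing on every bond with both endpoints in the block of `x`
have the same `symTreeGaugeAt (toSite r) · N x` (in-block root). -/
theorem symTreeGaugeAt_congr {N : ℕ} (hN : 1 ≤ N) {r : Fin n → ℕ} (hr : r ∈ box n N) {A A' : Form1 n ℝ} {x : Site n}
    (h : ∀ κ z, blk N z = blk N x → blk N (z + unitVec κ) = blk N x → A κ z = A' κ z) :
    symTreeGaugeAt (toSite r) A N x = symTreeGaugeAt (toSite r) A' N x := by
  unfold symTreeGaugeAt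
  have hx : x = (N : ℤ) • blk N x + toSite (AveragingContours.off N x) := (AveragingContours.blk_add_off hN x).symm
  have key : ∀ x', x' = (N : ℤ) • blk N x + toSite (AveragingContours.off N x) →
      symAxial A ((N : ℤ) • blk N x + toSite r) x' = symAxial A' ((N : ℤ) • blk N x + toSite r) x' := by
    intro x' hx'
    subst hx'
    apply symAxial_congr_of_hull
    intro κ z hz hz'
    exact h κ z (blk_eq_of_inHull hN hr (AveragingContours.off_mem_box hN x) hz)
      (blk_eq_of_inHull hN hr (AveragingContours.off_mem_box hN x) hz')
  exact key x hx

/-- [folklore] Additivity of the symmetrised tree gauge. -/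
theorem symTreeGaugeAt_add (ρ : Site n) (A A' : Form1 n ℝ) (N : ℕ) (x : Site n) :
    symTreeGaugeAt ρ (A + A') N x = symTreeGaugeAt ρ A N x + symTreeGaugeAt ρ A' N x := by
  have h := symTreeGaugeAt_sub ρ (A + A') A' N x
  rw [add_sub_cancel_right] at h
  linarith

/-- [folklore] The symmetrised tree gauge of the zero form vanishes. -/
theorem symTreeGaugeAt_zero (ρ : Site n) (N : ℕ) (x : Site n) : symTreeGaugeAt ρ (0 : Form1 n ℝ) N x = 0 := by
  have h := symTreeGaugeAt_sub ρ (0 : Form1 n ℝ) 0 N x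
  rw [sub_self] at h
  linarith

/-- [folklore] Homogeneity of the symmetrised tree gauge (any dimension; cf. `SymmetrisedDressingReflection.symTreeGaugeAt_mulLeft`). -/
theorem symTreeGaugeAt_mulLeft' (ρ : Site n) (c : ℝ) (A : Form1 n ℝ) (N : ℕ) (x : Site n) :
    symTreeGaugeAt ρ (fun κ z => c * A κ z) N x = c * symTreeGaugeAt ρ A N x := by
  have hax : ∀ (σ : Equiv.Perm (Fin n)) (y x : Site n), axialPerm σ (fun κ z => c * A κ z) y x = c * axialPerm σ A y x := by
    intro σ y x
    unfold axialPerm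
    have hP : P1 σ (fun κ z => c * A κ z) = fun κ z => (AddMonoidHom.mulLeft c) (P1 σ A κ z) := by
      funext κ z; simp only [P1_apply, AddMonoidHom.coe_mulLeft]
    rw [hP, AxialProjector.axial_map, ← map_list_sum]
    rfl
  simp only [symTreeGaugeAt, symAxial, hax, Finset.mul_sum]

/-- [folklore] **LINEARITY OVER FINITE SUMS**: `symTreeGaugeAt ρ (Σ_i c_i • B_i) N x = Σ_i c_i · symTreeGaugeAt ρ B_i N x`. -/
theorem symTreeGaugeAt_sum {ι : Type*} (s : Finset ι) (c : ι → ℝ) (B : ι → Form1 n ℝ) (ρ : Site n) (N : ℕ) (x : Site n) :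
    symTreeGaugeAt ρ (fun κ z => ∑ i ∈ s, c i * B i κ z) N x = ∑ i ∈ s, c i * symTreeGaugeAt ρ (B i) N x := by
  classical
  induction s using Finset.induction_on with
  | empty =>
    simp only [Finset.sum_empty]
    exact symTreeGaugeAt_zero ρ N x
  | insert a s ha ih =>
    rw [Finset.sum_insert ha, ← ih, ← symTreeGaugeAt_mulLeft', ← symTreeGaugeAt_add]
    congr 1
    funext κ z
    rw [Pi.add_apply, Pi.add_apply, Finset.sum_insert ha]

/-! ## §2 The block index types, the matrix `Gmat`, its right inverse `Dmat` -/

/-- [our object] The finite set of INTERIOR bonds `(α, b)` of block `0`: `b ∈ box` and `b_α + 1 < N` (both endpoints in the block). -/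
def bIdxSet (n N : ℕ) : Finset (Fin n × (Fin n → ℕ)) := ((Finset.univ : Finset (Fin n)) ×ˢ box n N).filter fun j => j.2 j.1 + 1 < N

/-- [folklore] Membership in `bIdxSet`. -/
theorem mem_bIdxSet {N : ℕ} {j : Fin n × (Fin n → ℕ)} : j ∈ bIdxSet n N ↔ j.2 ∈ box n N ∧ j.2 j.1 + 1 < N := by
  simp [bIdxSet, Finset.mem_filter, Finset.mem_product]

/-- [our object] The index type of interior bonds of block `0`. -/
abbrev BIdx (n N : ℕ) : Type := {j : Fin n × (Fin n → ℕ) // j ∈ bIdxSet n N}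

/-- [our object] The finite set of NON-ROOT sites of block `0`. -/
def cIdxSet (n N : ℕ) : Finset (Fin n → ℕ) := (box n N).erase (ctrOff n N)

/-- [our object] The index type of the non-root sites of block `0` (the constraints of the symmetrised gauge at the centred root). -/
abbrev CIdx (n N : ℕ) : Type := {b : Fin n → ℕ // b ∈ cIdxSet n N}

/-- [our object] **THE BLOCK MATRIX OF THE SYMMETRISED GAUGE FUNCTIONAL** (block `0`, centred root): `Gmat N z j := symTreeGaugeAt ρ_c δ_j N (toSite z)`. -/
def Gmat (N : ℕ) : Matrix (CIdx n N) (BIdx n N) ℝ := fun z j => symTreeGaugeAt (ctr n N) (bondIndR j.1.1 (toSite j.1.2)) N (toSite z.1)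

/-- [our object] **THE RIGHT INVERSE**: `Dmat N j z := (n!)⁻¹ · (grad 1_{toSite z})(j)`. -/
def Dmat (N : ℕ) : Matrix (BIdx n N) (CIdx n N) ℝ := fun j z =>
  (n ! : ℝ)⁻¹ * ((if toSite j.1.2 + unitVec j.1.1 = toSite z.1 then 1 else 0) - (if toSite j.1.2 = toSite z.1 then 1 else 0))

/-- [folklore] Block `0` points are `toSite` of box offsets. -/
theorem blk_toSite {N : ℕ} {b : Fin n → ℕ} (hb : b ∈ box n N) : blk N (toSite b) = 0 := by
  have h := blk_block (L := N) (0 : Site n) hb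
  simpa using h


/-- [folklore] **THE FINITE EXPANSION**: for a block-`0` point `x`, `symTreeGaugeAt ρ_c A N x = Σ_{j interior} A(j) · symTreeGaugeAt ρ_c δ_j N x` (`N ≥ 1`). -/
theorem symTreeGaugeAt_expand {N : ℕ} (hN : 1 ≤ N) (A : Form1 n ℝ) {x : Site n} (hx : blk N x = 0) :
    symTreeGaugeAt (ctr n N) A N x = ∑ j : BIdx n N, A j.1.1 (toSite j.1.2) * symTreeGaugeAt (ctr n N) (bondIndR j.1.1 (toSite j.1.2)) N x := by
  classical
  rw [← symTreeGaugeAt_sum]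
  rw [show ctr n N = toSite (ctrOff n N) from rfl]
  apply symTreeGaugeAt_congr hN (ctrOff_mem_box hN)
  intro κ z hz hz'
  rw [hx] at hz hz'
  -- `z = toSite b` with `(κ, b)` interior
  have hz0 : z = toSite (AveragingContours.off N z) := by
    have := AveragingContours.blk_add_off hN z; rw [hz, smul_zero, zero_add] at this; exact this.symm
  set b := AveragingContours.off N z with hb
  have hbox : b ∈ box n N := AveragingContours.off_mem_box hN z
  have hint : (κ, b) ∈ bIdxSet n N := by
    rw [mem_bIdxSet]
    refine ⟨hbox, ?_⟩
    have a2 := lt_zsmul_blk_add hN (z + unitVec κ) κ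
    rw [hz'] at a2
    have a3 : (z + unitVec κ) κ < N := by simpa using a2
    rw [hz0] at a3
    simp only [Pi.add_apply, toSite, unitVec_apply, if_true] at a3
    exact_mod_cast a3
  rw [hz0]
  symm
  rw [Finset.sum_eq_single ⟨(κ, b), hint⟩]
  · simp [bondIndR_apply]
  · intro j _ hj
    rw [bondIndR_apply, if_neg, mul_zero]
    rintro ⟨h1, h2⟩
    apply hj
    have h2' : j.1.2 = b := by
      funext i
      have e := congrFun h2 i
      simp only [toSite, Nat.cast_inj] at e
      exact e.symm
    exact Subtype.ext (Prod.ext h1.symm h2')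
  · intro h; exact absurd (Finset.mem_univ _) h

/-! ## §3 `Gmat * Dmat = 1`: full row rank, the kernel projector is available -/

/-- [folklore] `toSite` is injective on offsets. -/
theorem toSite_inj {b b' : Fin n → ℕ} : toSite b = toSite b' ↔ b = b' := by
  constructor
  · intro h; funext i; have e := congrFun h i; simp only [toSite, Nat.cast_inj] at e; exact e
  · rintro rfl; rfl

/-- [folklore] **RIGHT INVERSE**: `Gmat N * Dmat N = 1` (`N ≥ 1`) — the symmetrised gauge functional composed with `(n!)⁻¹·grad∘(extension by zero at the
root)` is the identity on the non-root block sites (S1 `symTreeGaugeAt_grad`: exact forms are read at the point minus the root). -/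
theorem Gmat_mul_Dmat {N : ℕ} (hN : 1 ≤ N) : Gmat (n := n) N * Dmat (n := n) N = (1 : Matrix (CIdx n N) (CIdx n N) ℝ) := by
  classical
  ext z z'
  -- the site indicator of `toSite z'`
  set f : Form0 n ℝ := fun w => if w = toSite z'.1 then 1 else 0 with hf
  have hz0 : blk N (toSite z.1) = 0 := blk_toSite (Finset.mem_of_mem_erase z.2)
  have hexp := symTreeGaugeAt_expand hN (grad f) hz0
  have hgrad : symTreeGaugeAt (ctr n N) (grad f) N (toSite z.1) = (n ! : ℝ) * (f (toSite z.1) - f (ctr n N)) := by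
    rw [symTreeGaugeAt_grad, hz0, smul_zero, zero_add]
  rw [Matrix.mul_apply, Matrix.one_apply]
  have hD : ∀ j : BIdx n N, Gmat N z j * Dmat N j z' = (n ! : ℝ)⁻¹ * (grad f j.1.1 (toSite j.1.2) * symTreeGaugeAt (ctr n N) (bondIndR j.1.1 (toSite j.1.2)) N (toSite z.1)) := by
    intro j
    simp only [Gmat, Dmat, grad, hf]
    ring
  rw [Finset.sum_congr rfl (fun j _ => hD j), ← Finset.mul_sum, ← hexp, hgrad, ← mul_assoc,
    inv_mul_cancel₀ (Nat.cast_ne_zero.mpr (Nat.factorial_ne_zero n)), one_mul]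
  have hroot : f (ctr n N) = 0 := by
    rw [hf]; dsimp only
    rw [if_neg]
    rw [show ctr n N = toSite (ctrOff n N) from rfl, toSite_inj]
    exact fun e => (Finset.mem_erase.1 z'.2).1 e.symm
  rw [hroot, sub_zero, hf]
  dsimp only
  by_cases h : z = z'
  · subst h; simp
  · have h' : toSite z.1 ≠ toSite z'.1 := fun e => h (Subtype.ext (toSite_inj.1 e))
    rw [if_neg h', if_neg h]

/-- [folklore] **`Gmat N` HAS FULL ROW RANK**: its Gram matrix is invertible (`KernelOrthoProjector.isUnit_det_gram_of_mul_eq_one`). -/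
theorem isUnit_det_gram_Gmat {N : ℕ} (hN : 1 ≤ N) : IsUnit (Gmat (n := n) N * (Gmat N)ᵀ).det :=
  isUnit_det_gram_of_mul_eq_one (Gmat_mul_Dmat hN)

/-- [our object] **THE BLOCK SLICE PROJECTOR** `Pmat N := kerProj (Gmat N)` — the orthogonal projector onto `ker Gmat N` (symmetric, idempotent, `Gmat·P = 0`,
identity on the kernel: `KernelOrthoProjector`). -/
def Pmat (N : ℕ) : Matrix (BIdx n N) (BIdx n N) ℝ := kerProj (Gmat N)

/-! ## §4 Gauge-fixed forms give kernel vectors (so `Pmat` fixes the columns of `Π^{sym}_bm`) -/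

/-- [our object] The restriction of a form to the interior bonds of block `0`, as a vector. -/
def restrictV (N : ℕ) (C : Form1 n ℝ) : BIdx n N → ℝ := fun j => C j.1.1 (toSite j.1.2)

/-- [folklore] **A FORM IN THE SYMMETRISED SLICE RESTRICTS TO A KERNEL VECTOR**: `SymAxialGaugeAt ρ_c C N → Gmat N *ᵥ restrictV N C = 0`. -/
theorem Gmat_mulVec_restrictV_eq_zero {N : ℕ} (hN : 1 ≤ N) {C : Form1 n ℝ} (hC : SymAxialGaugeAt (ctr n N) C N) :
    Gmat N *ᵥ restrictV N C = 0 := by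
  funext z
  rw [Matrix.mulVec, Pi.zero_apply]
  show ∑ j, Gmat N z j * restrictV N C j = 0
  have hz0 : blk N (toSite z.1) = 0 := blk_toSite (Finset.mem_of_mem_erase z.2)
  have hexp := symTreeGaugeAt_expand hN C hz0
  have h0 : symTreeGaugeAt (ctr n N) C N (toSite z.1) = 0 := by
    rw [show ctr n N = toSite (ctrOff n N) from rfl] at hC ⊢
    rw [symTreeGaugeAt_eq_zero_of_symAxialGaugeAt hN hC]
    rfl
  rw [hexp] at h0
  rw [← h0]
  exact Finset.sum_congr rfl fun j _ => by simp only [Gmat, restrictV]; ring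

/-- [folklore] **`Pmat` FIXES THE RESTRICTION OF EVERY GAUGE-FIXED FORM** — in particular the columns of `Π^{sym}_bm` (S1f `symAxialGaugeAt_symAxProjBmAt`):
the block-level form of `symE ∘ Π̂ᵀ_sym = Π̂ᵀ_sym`. -/
theorem Pmat_mulVec_restrictV {N : ℕ} (hN : 1 ≤ N) {C : Form1 n ℝ} (hC : SymAxialGaugeAt (ctr n N) C N) :
    Pmat N *ᵥ restrictV N C = restrictV N C :=
  kerProj_mulVec_of_ker (Gmat N) (Gmat_mulVec_restrictV_eq_zero hN hC)

/-- [folklore] The columns of the symmetrised block-mean projector are fixed by `Pmat`: `Pmat *ᵥ (Π^{sym}_bm δ)|_{block 0} = (Π^{sym}_bm δ)|_{block 0}` (`N ≥ 1`). -/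
theorem Pmat_mulVec_pmSymBm {N : ℕ} (hN : 1 ≤ N) (α : Fin n) (q : Site n) :
    Pmat N *ᵥ restrictV N (symAxProjBmAt (ctr n N) N (bondIndR α q)) = restrictV N (symAxProjBmAt (ctr n N) N (bondIndR α q)) :=
  Pmat_mulVec_restrictV hN (symAxialGaugeAt_symAxProjBmAt hN (ctrOff_mem_box hN) (bondIndR α q))

end

end Summit.QuantumFields.BalabanUV.Beta.SymSliceBlockMatrix
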